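import Summits.QuantumFields.BalabanUV.Beta.GAN24.CombBorderWordsZero
import Summits.QuantumFields.BalabanUV.Beta.GAN24.CombVHEWordsZeroStep
import Summits.QuantumFields.BalabanUV.Beta.GAN24.EVHLatticeWordsSucc

/-!
# `BalabanUV.Beta.GAN24.CombEVHWordsZeroStep` — binder row G-an2-4 ∕ (CONV-C), TRANSFER-III, the (III′) (C)-campaign's supplier `hB0` AT LEVELS `j + 1 ≥ 1`:
# **(27) AT THE COMB DATA, LEVEL `j+1`, THE DIRECT WORD — THE `E′_c ⊗ VH′_{u′}` WORD WITH THE TRANSPORTED CUBIC SECTOR ON THE CELL BOND VANISHES IN THE ZERO MODE AS SOON AS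
# THE EXIT-FACE CURRENT OF THE UNTRANSPORTED CUBIC SECTOR `c₀ • e3OfK Lc G_j M` IS DIVERGENCE-FREE (D) WITH ZERO CELL TOTALS (Z)** — leaf-01 g86's D2 `CombBorderWordsZero` (whose
# left family is the transported level-`0` table `𝒯(cE • wilsonA)`; its header: «at levels ≥ 1 the comb E-sector's own left face read is NOT treated») re-run with F6
# `CombForcingSectorSplit.dM_comb_succ_split`'s level-`(j+1)` sector `E′ = 𝒯(c₀ • e3OfK Lc G_j M)` for a GENERIC local, block-covariant member `M` with parity-odd rows (at the
# comb data `M = 𝒯 S̃comb_j`, an1's record), the one table-specific input — leaf-04's flatness kill `VHWordsZeroCell.sum_box_leftFamily_face_eq_zero` — replaced by leaf-04 g69's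
# level-`(j+1)` cell identity `EVHLatticeWordsSucc.sum_box_leftFamily_face_eq_zero_succ` RE-TYPED FOR A GENERIC MEMBER WITH (D)∕(Z) DISPLAYED (the (P) input is leaf-01's C
# `CombVHEWordsZeroStep.sectorCurrent_periodic`); (D)_comb is leaf-01 g87's K `CombExitFaceCurrentDivFree.comb_exitFace_pairCurrent_divFree`, (Z)_comb is OPEN
# (G-an2-4 ∕ (CONV-C) OWNER `b2b-balaban-gan24-p1`, gen 53; journal [GAN24P1-G53-INTENT-1])

NOT IN PRINT; OUR BOOKKEEPING ([folklore] BY NAME over leaf-01 g86 A1 `TransportedWordTools` ∕ A2 `TransportedWordReduction` ∕ D1 `CombBorderWordTools` ∕ D2 `CombBorderWordsZero` ∕ C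
`CombVHEWordsZeroStep` §1, leaf-04's `VHWordsZeroCell` ∕ `VHWordsZeroBorder` ∕ `ExitFaceCurrentCellTotals.tsum_weight_current_eq_faceSlot` ∕ `PeriodicCurrentFaceFlux.sum_box_face_current_eq_zero` ∕
`CoarseBondCellPairing.sum_box_tsum_sum_mul_periodic_of_cov`, leaf-06 g52's `ExitFaceLeftFamily`; 0 `def`, 0 cited fact, 0 `def … : Prop`, 0 sorry).
HONEST FRAMING (cell contract, verbatim): «discharging `BetaPertH` makes Bałaban's UV stability UNCONDITIONAL — a real constructive-QFT result; it is NOT the continuum limit and NOT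
the Clay problem.»  HONEST DEPENDENCY (verbatim): «continuum YM on T⁴ ⇐ BetaPertH ∧ nine spine estimates (0/9 proved); BetaPertH ⇐ (D1) ∧ (D4) ∧ CAP+tail; G-an2-4 gates asym, D1
and NE2/3/4.»

## What is proved (generic `d`, `[NeZero Lc]`, `1 ≤ Lc`, in-block kernel root `toSite rb`, `G_j = coDressKBmAt (toSite rb) Lc (KInvStep Lc j)`, `X̃♮_{j+1}`, `T := κ t ↦ c₀ • e3OfK Lc G_j M κ t`, all units)
* §1 THE CELL IDENTITY OF THE CUBIC SECTOR's LEFT FAMILY, (D)∕(Z) DISPLAYED: `tsum_leftFamily_eq_neg_current` (`Σ'_u j_u(a,z) = −t(a,z)`, the exit-face pair current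
  `t b z := Σ'_{(u,w)} 𝟙f(w_γ)·V^T_{μ,u} z w (inl b)(inl γ)` — C's `hdiv`∕`h0` currency VERBATIM with `(ν, β) := (μ, γ)`), **`sum_box_leftFamily_face_eq_zero_of_divFree`**
  (`Σ_{c∈box} Σ'_{y₁} Σ_a j^γ_{toSite c}(a,y₁)·(𝟙f((y₁)_a)·κ_a) = 0` GIVEN `hdiv`∕`h0` on `t` — covariance regrouping, §1's first lemma, the slab lemma with (P) from C).
* §2 THE WORDS, ANY TRANSPORT ROOT `r ∈ box`, border `S′` local ∕ no ff block ∕ block-covariant ∕ multiplier legs coarse, `𝒯S κ u := Ψ̂ᵀ∘slotPsiS r Lc S κ u∘Ψ̂`: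
  **`sum_box_transported_sector_border_word_eq_zero_of_divFree`** (DIRECT, zero mode: `Σ_{c} Σ'_{u′} FF[(vertexOfK X̃♮_{j+1} Lc (unitS (𝒯T)) μ c ∘ X̃♮_{j+1}) ∘ vertexOfK X̃♮_{j+1} Lc (unitS (𝒯S′)) ν u′] = 0`
  GIVEN (D)∕(Z) on the `α`-read current of `V^T_μ`) — D2's route token for token (A1 outer legs drop; D1 §1 sandwich fm charges; A2 border current untransported; D1 §3 left-family slot
  drop in the cell sum; then §1).  The SWAP word is the companion module `CombEVHSwapWordZeroStep`.
* §3 AT THE COMB DATA (`r = rb = ctrOff (d+1) Lc`, root `ctr (d+1) Lc`, an1's record `tabs = symTablesAn1S2 d Lc cΛt`, `M = 𝒯 (ScombOf tabs cE cVH cΛ j)`, `c₀ = cE·wE_{j+1}`, border `c • symVhSAt ρ_c`):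
  **`comb_eVH_word_succ_eq_zero_of_divFree`** — F6 `dM_comb_succ_split`'s `V^E′_c ⊗ V^VH′_{u′}` direct word at level `j+1` vanishes in the zero mode GIVEN (D)_comb ∧ (Z)_comb of the
  untransported comb E-sector's `α`-read current (displayed `hdiv`, `h0`; (D)_comb := K §3 at `(ν, β) := (μ, α)`).
WHAT THIS IS NOT: (Z)_comb is NOT proved; NO value; NOT `hB0`; the `E′⊗E′` pair form at level `j+1` (J2 at the comb) is NOT treated; NEVER «G-an2-4 closed» as (CONV-C); NOT D1, NOT
`BetaPertH`, NOT continuum, NOT Clay.  2026-08-27; no existing file touched.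
-/

noncomputable section

open Finset
open scoped BigOperators
open Literature.MathematicalPhysics.QuantumFieldTheory
open Literature.MathematicalPhysics.QuantumFieldTheory.Balaban1983to89
open Literature.MathematicalPhysics.QuantumFieldTheory.Balaban1983to89.Beta
open ExpKernelCalculus (Site MKer comp shiftK Decays BiLoc VertexFamily)
open BalabanStepJetsSucc (biLoc_comp_right wE)
open AffineAveraging (box toSite unitVec)
open AveragingContours (off)
open AveragingContoursRooted (ctr ctrOff ctrOff_mem_box)
open OneStepResolventKernel (Fib LocStencil decays_mono biLoc_mono)
open OneStepKernelFamily (KInvStep vertexOfK vertexFamily_vertexOfK decays_KInvStep)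
open StepJetData (locStencil_smul)
open PeriodicDescent (IsPeriodic)
open Summit.QuantumFields.BalabanUV.Beta.TameKernelCalculus (trK trK_apply trK_comp biLoc_trK Loc Spr Tame comp_assoc_tame comp_neg_left decays_trK)
open Summit.QuantumFields.BalabanUV.Beta.BorderedHessian (sgnK decays_sgnK)
open Summit.QuantumFields.BalabanUV.Beta.AxialDressingRooted (coDressKBmAt decays_coDressKBmAt)
open Summit.QuantumFields.BalabanUV.Beta.HessKerDressedUnits (unitK unitS decays_unitK locStencil_unitS)
open Summit.QuantumFields.BalabanUV.Beta.SpineRooted (e3OfK)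
open Summit.QuantumFields.BalabanUV.Beta.SymAveragingHessianCounts (symVhSAt)
open Summit.QuantumFields.BalabanUV.Beta.SymSecondOrderTablesAn1 (symTablesAn1S2)
open Summit.QuantumFields.BalabanUV.Beta.CombChartStepJets (ScombOf)
open Summit.QuantumFields.BalabanUV.Beta.SymCorrectorKernel (psiKS spr_psiKS)
open Summit.QuantumFields.BalabanUV.Beta.SymCorrectorFace (slotPsiS slotPsiS_shift)
open Summit.QuantumFields.BalabanUV.Beta.SymCorrectorSockets (locStencil_slotPsiS)
open Summit.QuantumFields.BalabanUV.Beta.GAN24.ExchangeSlotResum (face_weight_periodic tsum_twoFace_eq_trK)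
open Summit.QuantumFields.BalabanUV.Beta.GAN24.VHWordsZeroBorder (borderSlot_translate borderSlot_inr_fst_eq_zero borderSlot_inr_snd_eq_zero)
open Summit.QuantumFields.BalabanUV.Beta.GAN24.VHWordsZeroCell (tsum_ffLeft_profile_right_word_eq sum_fmCharge_mul sum_neg_fmCharge_mul)
open Summit.QuantumFields.BalabanUV.Beta.GAN24.VHWordsZeroLatticeStep (current_bounded)
open Summit.QuantumFields.BalabanUV.Beta.GAN24.ExitFaceLeftFamily (leftFamily_cov_of_translate summable_leftFamily_mul_of_locStencil tsum_leftFamily_eq_faceface)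
open Summit.QuantumFields.BalabanUV.Beta.GAN24.ExitFaceCurrentCellTotals (tsum_weight_current_eq_faceSlot)
open Summit.QuantumFields.BalabanUV.Beta.GAN24.PeriodicCurrentFaceFlux (sum_box_face_current_eq_zero)
open Summit.QuantumFields.BalabanUV.Beta.GAN24.CoarseBondCellPairing (sum_box_tsum_sum_mul_periodic_of_cov)
open Summit.QuantumFields.BalabanUV.Beta.GAN24.CombTransportedBorder (pos_Lc locStencil_symVhS symVhS_inl_inl symVhS_translate symVhS_inr_fst_eq_zero symVhS_inr_snd_eq_zero)
open Summit.QuantumFields.BalabanUV.Beta.GAN24.CombBorderWordsZero (slotPsiS_inr_fst_supp slotPsiS_inr_snd_supp)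
open Summit.QuantumFields.BalabanUV.Beta.GAN24.CombSlotResumTransport (vertexOfK_unitS_transport_eq_conj)
open Summit.QuantumFields.BalabanUV.Beta.GAN24.TransportedWordTools (exists_decays_sandwich spr_sandwich tsum_twoFace_conj_word_eq trK_vertexOfK_unitS_slotPsiS
  vertexOfK_unitS_slotPsiS_entry_eq_zero trK_sandwich_dressedStep sgnK_sandwich unitS_antisymm)
open Summit.QuantumFields.BalabanUV.Beta.GAN24.TransportedWordReduction (tsum_prod_weight_vertexOfK_dressedStep_slotPsiS)
open Summit.QuantumFields.BalabanUV.Beta.GAN24.CombBorderWordTools (hasSum_sandwich_dressedStep_fm_col hasSum_sandwich_sgnK_dressedStep_fm_col tsum_prod_weight_fst_vertexOfK_dressedStep_slotPsiS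
  sum_box_leftFamily_slotPsiS_eq)
open Summit.QuantumFields.BalabanUV.Beta.GAN24.CombVHEWordsZeroStep (sector_inr_left sector_inr_right exists_locStencil_sector sector_translate sector_antisymm vertexSector_translate
  sectorCurrent_periodic exists_locStencil_transport_ScombOf transport_ScombOf_translate parityOdd_transport_ScombOf)

namespace Summit.QuantumFields.BalabanUV.Beta.GAN24.CombEVHWordsZeroStep

variable {d : ℕ} {Lc : ℕ} [NeZero Lc] {rb : Fin (d + 1) → ℕ}

/-! ## §1 The cell identity of the cubic sector's face-weighted left family, (D)∕(Z) displayed -/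

section Cell

variable {M : Fin (d + 1) → Site (d + 1) → MKer (d + 1) (Fib d)} {CM δM : ℝ}

/-- [folklore] **`Σ'_u j_u(a, z) = −t(a, z)`** for the cubic sector `T = c₀ • e3OfK Lc G_j M` of a local parity-odd member: with `j_u(a,z) = Σ'_y 𝟙f(y_γ)·V^T_{μ,u} y z (inl γ)(inl a)`
(weighted leg first) and the exit-face pair current `t(a, z) = Σ'_{(u,w)} 𝟙f(w_γ)·V^T_{μ,u} z w (inl a)(inl γ)` (free leg first), both resum to the face-slot two-face current (leaf-06
`tsum_leftFamily_eq_faceface`, leaf-04 `tsum_weight_current_eq_faceSlot`), and `unitS T` is leg-antisymmetric (A1 `unitS_antisymm` on C `sector_antisymm`). -/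
theorem tsum_leftFamily_eq_neg_current (hrb : rb ∈ box (d + 1) Lc) (sf sm c₀ : ℝ) (j : ℕ) (hM : LocStencil M CM δM) (hδM : 0 < δM)
    (hMp : ∀ κ u, trK (M κ u) = -sgnK (M κ u)) (μ γ a : Fin (d + 1)) (z : Site (d + 1)) :
    ∑' u : Site (d + 1), ∑' y : Site (d + 1), (if y γ % (Lc : ℤ) = (Lc : ℤ) - 1 then (1 : ℝ) else 0) *
        vertexOfK (unitK sf sm (coDressKBmAt (toSite rb) Lc (KInvStep (d := d) Lc (j + 1)))) Lc
          (unitS sf sm (fun κ t => c₀ • e3OfK Lc (coDressKBmAt (toSite rb) Lc (KInvStep (d := d) Lc j)) M κ t)) μ u y z (Sum.inl γ) (Sum.inl a) =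
      -∑' uw : Site (d + 1) × Site (d + 1), (if uw.2 γ % (Lc : ℤ) = (Lc : ℤ) - 1 then (1 : ℝ) else 0) *
        vertexOfK (unitK sf sm (coDressKBmAt (toSite rb) Lc (KInvStep (d := d) Lc (j + 1)))) Lc
          (unitS sf sm (fun κ t => c₀ • e3OfK Lc (coDressKBmAt (toSite rb) Lc (KInvStep (d := d) Lc j)) M κ t)) μ uw.1 z uw.2 (Sum.inl a) (Sum.inl γ) := by
  have hLc : 1 ≤ Lc := Nat.one_le_iff_ne_zero.mpr (NeZero.ne Lc)
  obtain ⟨CE, δE, hδE, hSE⟩ := exists_locStencil_sector (d := d) hrb c₀ j hM hδM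
  have hS := locStencil_unitS (sf := sf) (sm := sm) hSE
  have hχ : ∀ w : Site (d + 1), |(if w γ % (Lc : ℤ) = (Lc : ℤ) - 1 then (1 : ℝ) else 0)| ≤ 1 := fun w => by split_ifs <;> simp
  rw [tsum_leftFamily_eq_faceface (μ := μ) (α := γ) hLc hrb hSE hδE sf sm (j + 1) a z, tsum_weight_current_eq_faceSlot hLc hrb sf sm (j + 1) hS hδE hχ μ z (Sum.inl a) (Sum.inl γ), ← mul_neg,
    ← tsum_neg]
  congr 1
  refine tsum_congr fun y => ?_
  rw [← mul_neg, ← tsum_neg]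
  congr 1
  refine tsum_congr fun t => ?_
  split_ifs
  · exact unitS_antisymm sf sm (fun κ' u' x' z' a' b' => sector_antisymm (rb := rb) hrb c₀ j hM hδM hMp κ' u' x' z' a' b') μ t z y (Sum.inl a) (Sum.inl γ)
  · rw [neg_zero]

/-- NOT IN PRINT; OUR BOOKKEEPING ([folklore]; leaf-04 g69's 27_{j+1} cell identity FOR A GENERIC MEMBER, (D)∕(Z) DISPLAYED).  **THE ZERO-MODE CELL IDENTITY FOR THE FACE-WEIGHTED LEFT
FAMILY OF THE CUBIC SECTOR AT LEVEL `j+1`**: for a local, block-covariant member `M` with parity-odd rows, any `μ γ`, any coefficients `κ_a`, IF the exit-face pair current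
`t b z := Σ'_{(u,w)} 𝟙f(w_γ)·V^T_{μ,u} z w (inl b)(inl γ)` is divergence-free (`hdiv`) with zero cell totals (`h0`), THEN `Σ_{c∈box Lc} Σ'_{y₁} Σ_a j^γ_{toSite c}(a, y₁)·(𝟙f((y₁)_a)·κ_a) = 0`
— covariance regroups the cell sum into the cell pairing of `Σ'_v j^γ_v = −t` (`CoarseBondCellPairing`, leaf-06's generic left-family lemmas, the first lemma), and the exit-face flux of `t` over
the cell vanishes by the slab lemma from (P) (C `sectorCurrent_periodic`), (D), (Z). -/
theorem sum_box_leftFamily_face_eq_zero_of_divFree (hrb : rb ∈ box (d + 1) Lc) (sf sm c₀ : ℝ) (j : ℕ) (hM : LocStencil M CM δM) (hδM : 0 < δM)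
    (hMt : ∀ (κ : Fin (d + 1)) (u t : Site (d + 1)), M κ (u + (Lc : ℤ) • t) = shiftK (-((Lc : ℤ) • t)) (M κ u)) (hMp : ∀ κ u, trK (M κ u) = -sgnK (M κ u))
    (μ γ : Fin (d + 1))
    (hdiv : ∀ p : Site (d + 1), ∑ b : Fin (d + 1),
      ((∑' uw : Site (d + 1) × Site (d + 1), (if uw.2 γ % (Lc : ℤ) = (Lc : ℤ) - 1 then (1 : ℝ) else 0) *
        vertexOfK (unitK sf sm (coDressKBmAt (toSite rb) Lc (KInvStep (d := d) Lc (j + 1)))) Lc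
          (unitS sf sm (fun κ t => c₀ • e3OfK Lc (coDressKBmAt (toSite rb) Lc (KInvStep (d := d) Lc j)) M κ t)) μ uw.1 p uw.2 (Sum.inl b) (Sum.inl γ)) -
       (∑' uw : Site (d + 1) × Site (d + 1), (if uw.2 γ % (Lc : ℤ) = (Lc : ℤ) - 1 then (1 : ℝ) else 0) *
        vertexOfK (unitK sf sm (coDressKBmAt (toSite rb) Lc (KInvStep (d := d) Lc (j + 1)))) Lc
          (unitS sf sm (fun κ t => c₀ • e3OfK Lc (coDressKBmAt (toSite rb) Lc (KInvStep (d := d) Lc j)) M κ t)) μ uw.1 (p - unitVec b) uw.2 (Sum.inl b) (Sum.inl γ))) = 0)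
    (h0 : ∀ b : Fin (d + 1), ∑ r' ∈ box (d + 1) Lc, ∑' uw : Site (d + 1) × Site (d + 1), (if uw.2 γ % (Lc : ℤ) = (Lc : ℤ) - 1 then (1 : ℝ) else 0) *
        vertexOfK (unitK sf sm (coDressKBmAt (toSite rb) Lc (KInvStep (d := d) Lc (j + 1)))) Lc
          (unitS sf sm (fun κ t => c₀ • e3OfK Lc (coDressKBmAt (toSite rb) Lc (KInvStep (d := d) Lc j)) M κ t)) μ uw.1 (toSite r') uw.2 (Sum.inl b) (Sum.inl γ) = 0)
    (κ : Fin (d + 1) → ℝ) :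
    ∑ c ∈ box (d + 1) Lc, ∑' y₁ : Site (d + 1), ∑ a : Fin (d + 1),
        (∑' y : Site (d + 1), (if y γ % (Lc : ℤ) = (Lc : ℤ) - 1 then (1 : ℝ) else 0) *
          vertexOfK (unitK sf sm (coDressKBmAt (toSite rb) Lc (KInvStep (d := d) Lc (j + 1)))) Lc
            (unitS sf sm (fun κ' t => c₀ • e3OfK Lc (coDressKBmAt (toSite rb) Lc (KInvStep (d := d) Lc j)) M κ' t)) μ (toSite c) y y₁ (Sum.inl γ) (Sum.inl a)) *
        ((if y₁ a % (Lc : ℤ) = (Lc : ℤ) - 1 then (1 : ℝ) else 0) * κ a) = 0 := by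
  classical
  have hLc1 : 1 ≤ Lc := Nat.one_le_iff_ne_zero.mpr (NeZero.ne Lc)
  obtain ⟨CE, δE, hδE, hSE⟩ := exists_locStencil_sector (d := d) hrb c₀ j hM hδM
  have hSt := fun (κ' : Fin (d + 1)) (u v : Site (d + 1)) => sector_translate (rb := rb) (d := d) c₀ j hMt κ' u v
  have hAp : ∀ (a : Fin (d + 1)) (y s : Site (d + 1)), (if (y + (Lc : ℤ) • s) a % (Lc : ℤ) = (Lc : ℤ) - 1 then (1 : ℝ) else 0) * κ a = (if y a % (Lc : ℤ) = (Lc : ℤ) - 1 then (1 : ℝ) else 0) * κ a :=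
    fun a y s => by rw [face_weight_periodic Lc a y s]
  have hAb : ∀ (a : Fin (d + 1)) (y : Site (d + 1)), |(if y a % (Lc : ℤ) = (Lc : ℤ) - 1 then (1 : ℝ) else 0) * κ a| ≤ ∑ a' : Fin (d + 1), |κ a'| := by
    intro a y
    have h1 : |(if y a % (Lc : ℤ) = (Lc : ℤ) - 1 then (1 : ℝ) else 0) * κ a| ≤ |κ a| := by
      rw [abs_mul]; exact mul_le_of_le_one_left (abs_nonneg _) (by split_ifs <;> simp)
    exact h1.trans (Finset.single_le_sum (f := fun a' => |κ a'|) (fun _ _ => abs_nonneg _) (Finset.mem_univ a))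
  rw [sum_box_tsum_sum_mul_periodic_of_cov (N := Lc)
    (j := fun (u : Site (d + 1)) (a : Fin (d + 1)) (y₁ : Site (d + 1)) => ∑' y : Site (d + 1), (if y γ % (Lc : ℤ) = (Lc : ℤ) - 1 then (1 : ℝ) else 0) *
      vertexOfK (unitK sf sm (coDressKBmAt (toSite rb) Lc (KInvStep (d := d) Lc (j + 1)))) Lc
        (unitS sf sm (fun κ' t => c₀ • e3OfK Lc (coDressKBmAt (toSite rb) Lc (KInvStep (d := d) Lc j)) M κ' t)) μ u y y₁ (Sum.inl γ) (Sum.inl a))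
    (A := fun a y₁ => (if y₁ a % (Lc : ℤ) = (Lc : ℤ) - 1 then (1 : ℝ) else 0) * κ a)
    (fun u a y₁ t => leftFamily_cov_of_translate (r := rb) (μ := μ) (α := γ) hLc1 hSt sf sm (j + 1) u a y₁ t) (fun a y s => hAp a y s)
    (fun u a => summable_leftFamily_mul_of_locStencil (μ := μ) (α := γ) hLc1 hrb hSE hδE sf sm (j + 1) (fun y => hAb a y) u a)]
  refine mul_eq_zero_of_right _ ?_
  simp only [tsum_leftFamily_eq_neg_current hrb sf sm c₀ j hM hδM hMp μ γ]
  -- the slab lemma for the exit-face pair current `t`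
  have hflux := fun a : Fin (d + 1) => sum_box_face_current_eq_zero (N := Lc)
    (T := fun b z => ∑' uw : Site (d + 1) × Site (d + 1), (if uw.2 γ % (Lc : ℤ) = (Lc : ℤ) - 1 then (1 : ℝ) else 0) *
      vertexOfK (unitK sf sm (coDressKBmAt (toSite rb) Lc (KInvStep (d := d) Lc (j + 1)))) Lc
        (unitS sf sm (fun κ' t => c₀ • e3OfK Lc (coDressKBmAt (toSite rb) Lc (KInvStep (d := d) Lc j)) M κ' t)) μ uw.1 z uw.2 (Sum.inl b) (Sum.inl γ))
    (fun b z s => by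
      beta_reduce
      exact sectorCurrent_periodic (rb := rb) hLc1 sf sm c₀ j hMt μ γ (Sum.inl b) (Sum.inl γ) z s)
    (fun z => hdiv z) (fun b => h0 b) a
  have e : ∀ r' ∈ box (d + 1) Lc, ∑ a : Fin (d + 1),
      (-(∑' uw : Site (d + 1) × Site (d + 1), (if uw.2 γ % (Lc : ℤ) = (Lc : ℤ) - 1 then (1 : ℝ) else 0) *
        vertexOfK (unitK sf sm (coDressKBmAt (toSite rb) Lc (KInvStep (d := d) Lc (j + 1)))) Lc
          (unitS sf sm (fun κ' t => c₀ • e3OfK Lc (coDressKBmAt (toSite rb) Lc (KInvStep (d := d) Lc j)) M κ' t)) μ uw.1 (toSite r') uw.2 (Sum.inl a) (Sum.inl γ))) *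
        ((if toSite r' a % (Lc : ℤ) = (Lc : ℤ) - 1 then (1 : ℝ) else 0) * κ a) =
      ∑ a : Fin (d + 1), (-κ a) * ((if toSite r' a % (Lc : ℤ) = (Lc : ℤ) - 1 then (1 : ℝ) else 0) *
        ∑' uw : Site (d + 1) × Site (d + 1), (if uw.2 γ % (Lc : ℤ) = (Lc : ℤ) - 1 then (1 : ℝ) else 0) *
          vertexOfK (unitK sf sm (coDressKBmAt (toSite rb) Lc (KInvStep (d := d) Lc (j + 1)))) Lc
            (unitS sf sm (fun κ' t => c₀ • e3OfK Lc (coDressKBmAt (toSite rb) Lc (KInvStep (d := d) Lc j)) M κ' t)) μ uw.1 (toSite r') uw.2 (Sum.inl a) (Sum.inl γ)) :=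
    fun r' _ => Finset.sum_congr rfl fun a _ => by ring
  rw [Finset.sum_congr rfl e, Finset.sum_comm]
  refine Finset.sum_eq_zero fun a _ => ?_
  rw [← Finset.mul_sum, hflux a, mul_zero]

end Cell

/-! ## §2 Level `j+1`: the transported cubic sector on the cell bond against a transported border, (D)∕(Z) displayed -/

section Words

variable {r : Fin (d + 1) → ℕ} {S' M : Fin (d + 1) → Site (d + 1) → MKer (d + 1) (Fib d)} {Cs δs CM δM : ℝ} {μ ν α β : Fin (d + 1)}

/-- NOT IN PRINT; OUR BOOKKEEPING ([folklore]; (27) AT THE COMB DATA, LEVEL `j+1`, THE DIRECT WORD, ZERO MODE, (D)∕(Z) DISPLAYED).  In-block kernel root `toSite rb`, ANY transport root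
`r ∈ box`, `1 ≤ Lc`, all units, any `c₀`, all axes; `M` local, block-covariant, parity-odd rows; `S′` local, no ff block, block-covariant, multiplier FIRST legs coarse: IF the `α`-read
exit-face pair current `t b z := Σ'_{(u,w)} 𝟙f(w_α)·V^T_{μ,u} z w (inl b)(inl α)` of the UNTRANSPORTED cubic sector `T = c₀ • e3OfK Lc G_j M` is divergence-free (`hdiv`) with zero cell
totals (`h0`), THEN `Σ_{c ∈ box Lc} Σ'_{u′} Σ'_{(y,w)} 𝟙f(y_α)𝟙f(w_β)·((vertexOfK X̃♮_{j+1} Lc (unitS (𝒯T)) μ c ∘ X̃♮_{j+1}) ∘ vertexOfK X̃♮_{j+1} Lc (unitS (𝒯S′)) ν u′) y w (inl α)(inl β) = 0`.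
ROUTE (D2's, token for token): per bond A1 `tsum_twoFace_conj_word_eq` (outer legs drop) ⨾ leaf-04 `tsum_ffLeft_profile_right_word_eq` with `P :=` the sector vertex over `unitS (slotPsiS T)`
(no fm block: C `sector_inr_right`), `Y := Ψ̂X̃♮_{j+1}Ψ̂ᵀ` (fm charges D1 §1), `Q :=` the border vertex over `unitS (slotPsiS S′)` ⨾ its resummed multiplier current untransported (A2 §1) ⨾
`sum_fmCharge_mul` ⨾ in the cell sum D1 §3 `sum_box_leftFamily_slotPsiS_eq` (C `sector_translate`) ⨾ §1 `sum_box_leftFamily_face_eq_zero_of_divFree`. -/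
theorem sum_box_transported_sector_border_word_eq_zero_of_divFree (hLc : 1 ≤ Lc) (hrb : rb ∈ box (d + 1) Lc) (hr : r ∈ box (d + 1) Lc) (sf sm c₀ : ℝ) (j : ℕ)
    (hM : LocStencil M CM δM) (hδM : 0 < δM) (hMt : ∀ (κ : Fin (d + 1)) (u t : Site (d + 1)), M κ (u + (Lc : ℤ) • t) = shiftK (-((Lc : ℤ) • t)) (M κ u))
    (hMp : ∀ κ u, trK (M κ u) = -sgnK (M κ u))
    (hS' : LocStencil S' Cs δs) (hδs : 0 < δs) (hS'ff : ∀ (κ' : Fin (d + 1)) (t x z : Site (d + 1)) (α' a : Fin (d + 1)), S' κ' t x z (Sum.inl α') (Sum.inl a) = 0)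
    (hS'cov : ∀ (κ : Fin (d + 1)) (u t : Site (d + 1)), S' κ (u + (Lc : ℤ) • t) = shiftK (-((Lc : ℤ) • t)) (S' κ u))
    (hS'supp : ∀ (κ : Fin (d + 1)) (t z w : Site (d + 1)) (m : Fin (d + 1)) (b : Fib d), off Lc z ≠ 0 → S' κ t z w (Sum.inr m) b = 0)
    (hdiv : ∀ p : Site (d + 1), ∑ b : Fin (d + 1),
      ((∑' uw : Site (d + 1) × Site (d + 1), (if uw.2 α % (Lc : ℤ) = (Lc : ℤ) - 1 then (1 : ℝ) else 0) *
        vertexOfK (unitK sf sm (coDressKBmAt (toSite rb) Lc (KInvStep (d := d) Lc (j + 1)))) Lc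
          (unitS sf sm (fun κ t => c₀ • e3OfK Lc (coDressKBmAt (toSite rb) Lc (KInvStep (d := d) Lc j)) M κ t)) μ uw.1 p uw.2 (Sum.inl b) (Sum.inl α)) -
       (∑' uw : Site (d + 1) × Site (d + 1), (if uw.2 α % (Lc : ℤ) = (Lc : ℤ) - 1 then (1 : ℝ) else 0) *
        vertexOfK (unitK sf sm (coDressKBmAt (toSite rb) Lc (KInvStep (d := d) Lc (j + 1)))) Lc
          (unitS sf sm (fun κ t => c₀ • e3OfK Lc (coDressKBmAt (toSite rb) Lc (KInvStep (d := d) Lc j)) M κ t)) μ uw.1 (p - unitVec b) uw.2 (Sum.inl b) (Sum.inl α))) = 0)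
    (h0 : ∀ b : Fin (d + 1), ∑ r' ∈ box (d + 1) Lc, ∑' uw : Site (d + 1) × Site (d + 1), (if uw.2 α % (Lc : ℤ) = (Lc : ℤ) - 1 then (1 : ℝ) else 0) *
        vertexOfK (unitK sf sm (coDressKBmAt (toSite rb) Lc (KInvStep (d := d) Lc (j + 1)))) Lc
          (unitS sf sm (fun κ t => c₀ • e3OfK Lc (coDressKBmAt (toSite rb) Lc (KInvStep (d := d) Lc j)) M κ t)) μ uw.1 (toSite r') uw.2 (Sum.inl b) (Sum.inl α) = 0) :
    ∑ c ∈ box (d + 1) Lc, ∑' u' : Site (d + 1), ∑' yw : Site (d + 1) × Site (d + 1), (if yw.1 α % (Lc : ℤ) = (Lc : ℤ) - 1 then (1 : ℝ) else 0) * (if yw.2 β % (Lc : ℤ) = (Lc : ℤ) - 1 then (1 : ℝ) else 0) *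
        comp (comp (vertexOfK (unitK sf sm (coDressKBmAt (toSite rb) Lc (KInvStep (d := d) Lc (j + 1)))) Lc
            (unitS sf sm (fun κ u => comp (comp (trK (psiKS r Lc)) (slotPsiS r Lc
              (fun κ t => c₀ • e3OfK Lc (coDressKBmAt (toSite rb) Lc (KInvStep (d := d) Lc j)) M κ t) κ u)) (psiKS r Lc))) μ (toSite c))
          (unitK sf sm (coDressKBmAt (toSite rb) Lc (KInvStep (d := d) Lc (j + 1)))))
          (vertexOfK (unitK sf sm (coDressKBmAt (toSite rb) Lc (KInvStep (d := d) Lc (j + 1)))) Lc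
            (unitS sf sm (fun κ u => comp (comp (trK (psiKS r Lc)) (slotPsiS r Lc S' κ u)) (psiKS r Lc))) ν u') yw.1 yw.2 (Sum.inl α) (Sum.inl β) = 0 := by
  classical
  have hLc0 : 0 < Lc := hLc
  set X := unitK sf sm (coDressKBmAt (toSite rb) Lc (KInvStep (d := d) Lc (j + 1))) with hX
  set T : Fin (d + 1) → Site (d + 1) → MKer (d + 1) (Fib d) := fun κ t => c₀ • e3OfK Lc (coDressKBmAt (toSite rb) Lc (KInvStep (d := d) Lc j)) M κ t with hTdef
  -- common-rate data
  obtain ⟨δK, CK, hδK, hCK, hXd⟩ := decays_coDressKBmAt hLc hrb (decays_KInvStep (d := d) (Lc := Lc) (j + 1))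
  have hXu : Decays X (max |sf| |sm| * CK * max |sf| |sm|) δK := decays_unitK (sf := sf) (sm := sm) hXd
  have hCX : 0 ≤ max |sf| |sm| * CK * max |sf| |sm| := by positivity
  have hCs : 0 ≤ Cs := (hS' 0 0).nonneg (Sum.inl 0)
  obtain ⟨CT, δT, hδT, hT0⟩ := exists_locStencil_sector (rb := rb) (d := d) hrb c₀ j hM hδM
  have hCT : 0 ≤ CT := (hT0 0 0).nonneg (Sum.inl 0)
  set δ₁ : ℝ := min δK (min δs δT) with hδ₁
  have hδ₁0 : 0 < δ₁ := lt_min hδK (lt_min hδs hδT)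
  have hX1 : Decays X (max |sf| |sm| * CK * max |sf| |sm|) δ₁ := decays_mono hXu hCX le_rfl (min_le_left _ _)
  have hXspr : Spr X := ⟨_, _, hδ₁0, hX1⟩
  have hT1 : LocStencil T CT δ₁ := fun κ' u => biLoc_mono (hT0 κ' u) hCT ((min_le_right _ _).trans (min_le_right _ _))
  have hS1 : LocStencil S' Cs δ₁ := fun κ' u => biLoc_mono (hS' κ' u) hCs ((min_le_right _ _).trans (min_le_left _ _))
  have hTs := locStencil_slotPsiS (d := d) hLc0 r hT1 hδ₁0.le
  have hSs := locStencil_slotPsiS (d := d) hLc0 r hS1 hδ₁0.le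
  have hPf := vertexFamily_vertexOfK (N := Lc) hX1 hCX (locStencil_unitS (sf := sf) (sm := sm) hTs) hδ₁0 le_rfl
  have hQf := vertexFamily_vertexOfK (N := Lc) hX1 hCX (locStencil_unitS (sf := sf) (sm := sm) hSs) hδ₁0 le_rfl
  have hCp := (hPf μ 0).nonneg (Sum.inl 0)
  have hCq := (hQf μ 0).nonneg (Sum.inl 0)
  have h₁ : ∀ y : Site (d + 1), |(if y α % (Lc : ℤ) = (Lc : ℤ) - 1 then (1 : ℝ) else 0)| ≤ 1 := fun y => by split_ifs <;> simp
  have h₂ : ∀ w : Site (d + 1), |(if w β % (Lc : ℤ) = (Lc : ℤ) - 1 then (1 : ℝ) else 0)| ≤ 1 := fun w => by split_ifs <;> simp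
  have hSscov : ∀ (κ : Fin (d + 1)) (u t : Site (d + 1)), slotPsiS r Lc S' κ (u + (Lc : ℤ) • t) = shiftK (-((Lc : ℤ) • t)) (slotPsiS r Lc S' κ u) :=
    fun κ u t => slotPsiS_shift hLc0 r hS'cov κ u t
  have hTcov : ∀ (κ : Fin (d + 1)) (u t : Site (d + 1)), T κ (u + (Lc : ℤ) • t) = shiftK (-((Lc : ℤ) • t)) (T κ u) :=
    fun κ u t => by rw [hTdef]; exact sector_translate (rb := rb) (d := d) c₀ j hMt κ u ((Lc : ℤ) • t)
  have hTfm : ∀ (κ' : Fin (d + 1)) (t x z : Site (d + 1)) (α' m : Fin (d + 1)), T κ' t x z (Sum.inl α') (Sum.inr m) = 0 :=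
    fun κ' t x z α' m => by rw [hTdef]; exact sector_inr_right (rb := rb) (d := d) c₀ j κ' t x z (Sum.inl α') m
  -- the sandwich middle kernel
  obtain ⟨CY, hCY, hY⟩ := exists_decays_sandwich hLc0 hr hX1 hδ₁0
  -- per cell bond
  have hval : ∀ c : Site (d + 1), (∑' u' : Site (d + 1), ∑' yw : Site (d + 1) × Site (d + 1), (if yw.1 α % (Lc : ℤ) = (Lc : ℤ) - 1 then (1 : ℝ) else 0) * (if yw.2 β % (Lc : ℤ) = (Lc : ℤ) - 1 then (1 : ℝ) else 0) *
        comp (comp (vertexOfK X Lc (unitS sf sm (fun κ u => comp (comp (trK (psiKS r Lc)) (slotPsiS r Lc T κ u)) (psiKS r Lc))) μ c) X)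
          (vertexOfK X Lc (unitS sf sm (fun κ u => comp (comp (trK (psiKS r Lc)) (slotPsiS r Lc S' κ u)) (psiKS r Lc))) ν u') yw.1 yw.2 (Sum.inl α) (Sum.inl β)) =
      ∑' y₁ : Site (d + 1), ∑ a : Fin (d + 1), (∑' y : Site (d + 1), (if y α % (Lc : ℤ) = (Lc : ℤ) - 1 then (1 : ℝ) else 0) *
          vertexOfK X Lc (unitS sf sm (slotPsiS r Lc T)) μ c y y₁ (Sum.inl α) (Sum.inl a)) *
        ((if y₁ a % (Lc : ℤ) = (Lc : ℤ) - 1 then (1 : ℝ) else 0) * (((Lc : ℝ) * (sm * sf)) * ((((Lc ^ (j + 1 + 1) : ℕ) : ℝ)) ^ (d + 1 + 1))⁻¹ *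
          (∑' uw : Site (d + 1) × Site (d + 1), (if uw.2 β % (Lc : ℤ) = (Lc : ℤ) - 1 then (1 : ℝ) else 0) * vertexOfK X Lc (unitS sf sm S') ν uw.1 0 uw.2 (Sum.inr a) (Sum.inl β)))) := by
    intro c
    -- (i) transports out of both vertices, outer legs drop
    have e : ∀ u' : Site (d + 1), (∑' yw : Site (d + 1) × Site (d + 1), (if yw.1 α % (Lc : ℤ) = (Lc : ℤ) - 1 then (1 : ℝ) else 0) * (if yw.2 β % (Lc : ℤ) = (Lc : ℤ) - 1 then (1 : ℝ) else 0) *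
          comp (comp (vertexOfK X Lc (unitS sf sm (fun κ u => comp (comp (trK (psiKS r Lc)) (slotPsiS r Lc T κ u)) (psiKS r Lc))) μ c) X)
            (vertexOfK X Lc (unitS sf sm (fun κ u => comp (comp (trK (psiKS r Lc)) (slotPsiS r Lc S' κ u)) (psiKS r Lc))) ν u') yw.1 yw.2 (Sum.inl α) (Sum.inl β)) =
        ∑' yw : Site (d + 1) × Site (d + 1), (if yw.1 α % (Lc : ℤ) = (Lc : ℤ) - 1 then (1 : ℝ) else 0) * (if yw.2 β % (Lc : ℤ) = (Lc : ℤ) - 1 then (1 : ℝ) else 0) *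
          comp (comp (vertexOfK X Lc (unitS sf sm (slotPsiS r Lc T)) μ c) (comp (comp (psiKS r Lc) X) (trK (psiKS r Lc))))
            (vertexOfK X Lc (unitS sf sm (slotPsiS r Lc S')) ν u') yw.1 yw.2 (Sum.inl α) (Sum.inl β) := by
      intro u'
      rw [vertexOfK_unitS_transport_eq_conj hLc0 hr hXspr sf sm hT1 hδ₁0 μ c, vertexOfK_unitS_transport_eq_conj hLc0 hr hXspr sf sm hS1 hδ₁0 ν u']
      exact tsum_twoFace_conj_word_eq hLc0 hr (hPf μ c) (half_pos hδ₁0) (hQf ν u') (half_pos hδ₁0) hX1 hδ₁0 h₁ (fun y s => face_weight_periodic Lc α y s) h₂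
        (fun w s => face_weight_periodic Lc β w s) _ _
    rw [tsum_congr e]
    -- (ii) leaf-04's reduction with the sandwich middle kernel and the slot-transported border
    have hP8 : BiLoc (vertexOfK X Lc (unitS sf sm (slotPsiS r Lc T)) μ c) ((Lc : ℤ) • c) ((Lc : ℤ) • c) _ (δ₁ / 8) := biLoc_mono (hPf μ c) hCp (by linarith)
    have hY4 : Decays (comp (comp (psiKS r Lc) X) (trK (psiKS r Lc))) CY (δ₁ / 4) := hY
    have hA := biLoc_comp_right (biLoc_mono (hPf μ c) hCp (show δ₁ / 4 ≤ δ₁ / 2 by linarith)) hY4 (show (0 : ℝ) ≤ δ₁ / 8 by positivity) (by linarith)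
    rw [tsum_ffLeft_profile_right_word_eq (N := Lc) (α := α) (β := β) (ρ₁ := fun y : Site (d + 1) => (if y α % (Lc : ℤ) = (Lc : ℤ) - 1 then (1 : ℝ) else 0))
      (ρ₂ := fun w : Site (d + 1) => (if w β % (Lc : ℤ) = (Lc : ℤ) - 1 then (1 : ℝ) else 0)) (show (0 : ℝ) < δ₁ / 8 by positivity) hP8
      (fun y z α' m => vertexOfK_unitS_slotPsiS_entry_eq_zero r X Lc sf sm (fun κ t x z' => hTfm κ t x z' α' m) μ c y z)
      (decays_mono hY4 hCY le_rfl (by linarith))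
      (fun y₁ a m => by rw [hX]; exact hasSum_sandwich_dressedStep_fm_col hLc0 hr hLc hrb sf sm (j + 1) y₁ a m) hA (fun u => biLoc_mono (hQf ν u) hCq (by linarith))
      (fun u s => by rw [hX]; exact borderSlot_translate (r := rb) hLc sf sm (j + 1) hSscov ν u s)
      (fun u z w b' b => vertexOfK_unitS_slotPsiS_entry_eq_zero r X Lc sf sm (fun κ t x z' => hS'ff κ t x z' b' b) ν u z w)
      (fun u z w m b hz => borderSlot_inr_fst_eq_zero X sf sm (slotPsiS_inr_fst_supp (Lc := Lc) r hS'supp) ν u z w m b hz) h₁ h₂ (fun w s => face_weight_periodic Lc β w s)]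
    refine tsum_congr fun y₁ => Finset.sum_congr rfl fun a _ => ?_
    congr 1
    -- (iii) the resummed multiplier current of the slot-transported border is the untransported one
    have et : ∀ m : Fin (d + 1), (∑' uw : Site (d + 1) × Site (d + 1), (if uw.2 β % (Lc : ℤ) = (Lc : ℤ) - 1 then (1 : ℝ) else 0) * vertexOfK X Lc (unitS sf sm (slotPsiS r Lc S')) ν uw.1 0 uw.2 (Sum.inr m) (Sum.inl β))
        = ∑' uw : Site (d + 1) × Site (d + 1), (if uw.2 β % (Lc : ℤ) = (Lc : ℤ) - 1 then (1 : ℝ) else 0) * vertexOfK X Lc (unitS sf sm S') ν uw.1 0 uw.2 (Sum.inr m) (Sum.inl β) := by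
      intro m
      rw [hX]
      exact tsum_prod_weight_vertexOfK_dressedStep_slotPsiS hLc hrb sf sm (j + 1) ν r hS' hδs h₂ 0 (Sum.inr m) (Sum.inl β)
    simp only [et]
    exact sum_fmCharge_mul (d := d) Lc sf sm (((((Lc ^ (j + 1 + 1) : ℕ) : ℝ)) ^ (d + 1 + 1))⁻¹)
      (fun m => ∑' uw : Site (d + 1) × Site (d + 1), (if uw.2 β % (Lc : ℤ) = (Lc : ℤ) - 1 then (1 : ℝ) else 0) * vertexOfK X Lc (unitS sf sm S') ν uw.1 0 uw.2 (Sum.inr m) (Sum.inl β)) y₁ a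
  simp only [hX] at hval
  rw [Finset.sum_congr rfl fun c _ => hval (toSite c)]
  -- (iv) the cell sum: drop the slot transport of the left family, then §1
  have hAb : ∀ (a : Fin (d + 1)) (y : Site (d + 1)), |(if y a % (Lc : ℤ) = (Lc : ℤ) - 1 then (1 : ℝ) else 0) * (((Lc : ℝ) * (sm * sf)) * ((((Lc ^ (j + 1 + 1) : ℕ) : ℝ)) ^ (d + 1 + 1))⁻¹ *
      (∑' uw : Site (d + 1) × Site (d + 1), (if uw.2 β % (Lc : ℤ) = (Lc : ℤ) - 1 then (1 : ℝ) else 0) *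
        vertexOfK (unitK sf sm (coDressKBmAt (toSite rb) Lc (KInvStep (d := d) Lc (j + 1)))) Lc (unitS sf sm S') ν uw.1 0 uw.2 (Sum.inr a) (Sum.inl β)))| ≤
      ∑ a' : Fin (d + 1), |((Lc : ℝ) * (sm * sf)) * ((((Lc ^ (j + 1 + 1) : ℕ) : ℝ)) ^ (d + 1 + 1))⁻¹ *
        (∑' uw : Site (d + 1) × Site (d + 1), (if uw.2 β % (Lc : ℤ) = (Lc : ℤ) - 1 then (1 : ℝ) else 0) *
          vertexOfK (unitK sf sm (coDressKBmAt (toSite rb) Lc (KInvStep (d := d) Lc (j + 1)))) Lc (unitS sf sm S') ν uw.1 0 uw.2 (Sum.inr a') (Sum.inl β))| := by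
    intro a y
    have h1 : |(if y a % (Lc : ℤ) = (Lc : ℤ) - 1 then (1 : ℝ) else 0) * (((Lc : ℝ) * (sm * sf)) * ((((Lc ^ (j + 1 + 1) : ℕ) : ℝ)) ^ (d + 1 + 1))⁻¹ *
        (∑' uw : Site (d + 1) × Site (d + 1), (if uw.2 β % (Lc : ℤ) = (Lc : ℤ) - 1 then (1 : ℝ) else 0) *
          vertexOfK (unitK sf sm (coDressKBmAt (toSite rb) Lc (KInvStep (d := d) Lc (j + 1)))) Lc (unitS sf sm S') ν uw.1 0 uw.2 (Sum.inr a) (Sum.inl β)))| ≤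
        |((Lc : ℝ) * (sm * sf)) * ((((Lc ^ (j + 1 + 1) : ℕ) : ℝ)) ^ (d + 1 + 1))⁻¹ *
          (∑' uw : Site (d + 1) × Site (d + 1), (if uw.2 β % (Lc : ℤ) = (Lc : ℤ) - 1 then (1 : ℝ) else 0) *
            vertexOfK (unitK sf sm (coDressKBmAt (toSite rb) Lc (KInvStep (d := d) Lc (j + 1)))) Lc (unitS sf sm S') ν uw.1 0 uw.2 (Sum.inr a) (Sum.inl β))| := by
      rw [abs_mul]; exact mul_le_of_le_one_left (abs_nonneg _) (by split_ifs <;> simp)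
    exact h1.trans (Finset.single_le_sum (f := fun a' => |((Lc : ℝ) * (sm * sf)) * ((((Lc ^ (j + 1 + 1) : ℕ) : ℝ)) ^ (d + 1 + 1))⁻¹ *
        (∑' uw : Site (d + 1) × Site (d + 1), (if uw.2 β % (Lc : ℤ) = (Lc : ℤ) - 1 then (1 : ℝ) else 0) *
          vertexOfK (unitK sf sm (coDressKBmAt (toSite rb) Lc (KInvStep (d := d) Lc (j + 1)))) Lc (unitS sf sm S') ν uw.1 0 uw.2 (Sum.inr a') (Sum.inl β))|)
      (fun _ _ => abs_nonneg _) (Finset.mem_univ a))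
  have hAp : ∀ (a : Fin (d + 1)) (y s : Site (d + 1)), (if (y + (Lc : ℤ) • s) a % (Lc : ℤ) = (Lc : ℤ) - 1 then (1 : ℝ) else 0) * (((Lc : ℝ) * (sm * sf)) * ((((Lc ^ (j + 1 + 1) : ℕ) : ℝ)) ^ (d + 1 + 1))⁻¹ *
      (∑' uw : Site (d + 1) × Site (d + 1), (if uw.2 β % (Lc : ℤ) = (Lc : ℤ) - 1 then (1 : ℝ) else 0) *
        vertexOfK (unitK sf sm (coDressKBmAt (toSite rb) Lc (KInvStep (d := d) Lc (j + 1)))) Lc (unitS sf sm S') ν uw.1 0 uw.2 (Sum.inr a) (Sum.inl β))) =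
      (if y a % (Lc : ℤ) = (Lc : ℤ) - 1 then (1 : ℝ) else 0) * (((Lc : ℝ) * (sm * sf)) * ((((Lc ^ (j + 1 + 1) : ℕ) : ℝ)) ^ (d + 1 + 1))⁻¹ *
      (∑' uw : Site (d + 1) × Site (d + 1), (if uw.2 β % (Lc : ℤ) = (Lc : ℤ) - 1 then (1 : ℝ) else 0) *
        vertexOfK (unitK sf sm (coDressKBmAt (toSite rb) Lc (KInvStep (d := d) Lc (j + 1)))) Lc (unitS sf sm S') ν uw.1 0 uw.2 (Sum.inr a) (Sum.inl β))) :=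
    fun a y s => by rw [face_weight_periodic Lc a y s]
  rw [sum_box_leftFamily_slotPsiS_eq (μ := μ) (γ := α) hLc hrb sf sm (j + 1) r hT0 hδT hTcov hAb hAp]
  exact sum_box_leftFamily_face_eq_zero_of_divFree (rb := rb) hrb sf sm c₀ j hM hδM hMt hMp μ α hdiv h0 _


end Words


/-! ## §3 At the comb data: the transported folded comb member of an1's record, an1's sym border -/

section Comb

variable {μ ν α β : Fin (d + 1)}

/-- NOT IN PRINT; OUR BOOKKEEPING ([folklore]; (27)_comb AT LEVEL `j+1`, THE DIRECT WORD — F6 `CombForcingSectorSplit.dM_comb_succ_split`'s `V^E′_cb ⊗ V^VH′_{u′}` word at an1's record).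
At the comb root `ρ_c = ctr (d+1) Lc`, transport `𝒯 = Ψ̂_Sᵀ∘slotPsiS (ctrOff) Lc∘Ψ̂_S`, record `tabs = symTablesAn1S2 d Lc cΛt`, all units, pins `cE cVH cΛ`, any border weight `c` (`= cVH·wVH_{j+1}` in F6),
every `j`, all axes: IF the `α`-read exit-face current of the UNTRANSPORTED comb E-sector `(cE·wE_{j+1}) • e3OfK Lc G_j (𝒯 S̃comb_j)` through `X̃_{j+1}` with slot direction `μ` is divergence-free
(`hdiv` = (D)_comb, leaf-01 g87's K §3 `comb_exitFace_pairCurrent_divFree`) with zero cell totals (`h0` = (Z)_comb, OPEN), THEN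
`Σ_{cb ∈ box Lc} Σ'_{u′} FF[(vertexOfK X̃_{j+1} Lc (unitS (𝒯((cE·wE_{j+1}) • e3OfK Lc G_j (𝒯 S̃comb_j)))) μ cb ∘ X̃_{j+1}) ∘ vertexOfK X̃_{j+1} Lc (unitS (𝒯 S^VH_c)) ν u′] = 0` — §2 at `r = rb = ctrOff (d+1) Lc`, `M = 𝒯 S̃comb_j`
(C `exists_locStencil_transport_ScombOf ∕ transport_ScombOf_translate ∕ parityOdd_transport_ScombOf`), border sockets F3 (`CombTransportedBorder`). -/
theorem comb_eVH_word_succ_eq_zero_of_divFree (sf sm cΛt cE cVH cΛ c : ℝ) (j : ℕ)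
    (hdiv : ∀ p : Site (d + 1), ∑ b : Fin (d + 1),
      ((∑' uw : Site (d + 1) × Site (d + 1), (if uw.2 α % (Lc : ℤ) = (Lc : ℤ) - 1 then (1 : ℝ) else 0) *
        vertexOfK (unitK sf sm (coDressKBmAt (ctr (d + 1) Lc) Lc (KInvStep (d := d) Lc (j + 1)))) Lc
          (unitS sf sm (fun κ t => (cE * wE d Lc (j + 1)) • e3OfK Lc (coDressKBmAt (ctr (d + 1) Lc) Lc (KInvStep (d := d) Lc j))
            (fun κ u => comp (comp (trK (psiKS (ctrOff (d + 1) Lc) Lc)) (slotPsiS (ctrOff (d + 1) Lc) Lc (ScombOf (symTablesAn1S2 d Lc cΛt) cE cVH cΛ j) κ u))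
              (psiKS (ctrOff (d + 1) Lc) Lc)) κ t)) μ uw.1 p uw.2 (Sum.inl b) (Sum.inl α)) -
       (∑' uw : Site (d + 1) × Site (d + 1), (if uw.2 α % (Lc : ℤ) = (Lc : ℤ) - 1 then (1 : ℝ) else 0) *
        vertexOfK (unitK sf sm (coDressKBmAt (ctr (d + 1) Lc) Lc (KInvStep (d := d) Lc (j + 1)))) Lc
          (unitS sf sm (fun κ t => (cE * wE d Lc (j + 1)) • e3OfK Lc (coDressKBmAt (ctr (d + 1) Lc) Lc (KInvStep (d := d) Lc j))
            (fun κ u => comp (comp (trK (psiKS (ctrOff (d + 1) Lc) Lc)) (slotPsiS (ctrOff (d + 1) Lc) Lc (ScombOf (symTablesAn1S2 d Lc cΛt) cE cVH cΛ j) κ u))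
              (psiKS (ctrOff (d + 1) Lc) Lc)) κ t)) μ uw.1 (p - unitVec b) uw.2 (Sum.inl b) (Sum.inl α))) = 0)
    (h0 : ∀ b : Fin (d + 1), ∑ r' ∈ box (d + 1) Lc, ∑' uw : Site (d + 1) × Site (d + 1), (if uw.2 α % (Lc : ℤ) = (Lc : ℤ) - 1 then (1 : ℝ) else 0) *
        vertexOfK (unitK sf sm (coDressKBmAt (ctr (d + 1) Lc) Lc (KInvStep (d := d) Lc (j + 1)))) Lc
          (unitS sf sm (fun κ t => (cE * wE d Lc (j + 1)) • e3OfK Lc (coDressKBmAt (ctr (d + 1) Lc) Lc (KInvStep (d := d) Lc j))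
            (fun κ u => comp (comp (trK (psiKS (ctrOff (d + 1) Lc) Lc)) (slotPsiS (ctrOff (d + 1) Lc) Lc (ScombOf (symTablesAn1S2 d Lc cΛt) cE cVH cΛ j) κ u))
              (psiKS (ctrOff (d + 1) Lc) Lc)) κ t)) μ uw.1 (toSite r') uw.2 (Sum.inl b) (Sum.inl α) = 0) :
    ∑ cb ∈ box (d + 1) Lc, ∑' u' : Site (d + 1), ∑' yw : Site (d + 1) × Site (d + 1), (if yw.1 α % (Lc : ℤ) = (Lc : ℤ) - 1 then (1 : ℝ) else 0) * (if yw.2 β % (Lc : ℤ) = (Lc : ℤ) - 1 then (1 : ℝ) else 0) *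
        comp (comp (vertexOfK (unitK sf sm (coDressKBmAt (ctr (d + 1) Lc) Lc (KInvStep (d := d) Lc (j + 1)))) Lc
            (unitS sf sm (fun κ u => comp (comp (trK (psiKS (ctrOff (d + 1) Lc) Lc)) (slotPsiS (ctrOff (d + 1) Lc) Lc
              (fun κ t => (cE * wE d Lc (j + 1)) • e3OfK Lc (coDressKBmAt (ctr (d + 1) Lc) Lc (KInvStep (d := d) Lc j))
            (fun κ u => comp (comp (trK (psiKS (ctrOff (d + 1) Lc) Lc)) (slotPsiS (ctrOff (d + 1) Lc) Lc (ScombOf (symTablesAn1S2 d Lc cΛt) cE cVH cΛ j) κ u))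
              (psiKS (ctrOff (d + 1) Lc) Lc)) κ t) κ u)) (psiKS (ctrOff (d + 1) Lc) Lc))) μ (toSite cb))
          (unitK sf sm (coDressKBmAt (ctr (d + 1) Lc) Lc (KInvStep (d := d) Lc (j + 1)))))
          (vertexOfK (unitK sf sm (coDressKBmAt (ctr (d + 1) Lc) Lc (KInvStep (d := d) Lc (j + 1)))) Lc
            (unitS sf sm (fun κ v => comp (comp (trK (psiKS (ctrOff (d + 1) Lc) Lc))
              (slotPsiS (ctrOff (d + 1) Lc) Lc (fun κ v => c • symVhSAt (ctr (d + 1) Lc) d Lc rfl κ v) κ v)) (psiKS (ctrOff (d + 1) Lc) Lc))) ν u')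
          yw.1 yw.2 (Sum.inl α) (Sum.inl β) = 0 := by
  have hLc : 1 ≤ Lc := Nat.one_le_iff_ne_zero.mpr (NeZero.ne Lc)
  obtain ⟨CM, δM, hδM, hM⟩ := exists_locStencil_transport_ScombOf (d := d) (Lc := Lc) cΛt cE cVH cΛ j
  exact sum_box_transported_sector_border_word_eq_zero_of_divFree (μ := μ) (ν := ν) (α := α) (β := β) hLc (ctrOff_mem_box (pos_Lc (Lc := Lc))) (ctrOff_mem_box (pos_Lc (Lc := Lc)))
    sf sm (cE * wE d Lc (j + 1)) j hM hδM (fun κ u t => transport_ScombOf_translate (d := d) (Lc := Lc) cΛt cE cVH cΛ j κ u t)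
    (fun κ u => parityOdd_transport_ScombOf (d := d) (Lc := Lc) cΛt cE cVH cΛ j κ u)
    (locStencil_symVhS (Lc := Lc) c zero_le_one) one_pos (fun κ' t x z α' a => symVhS_inl_inl (Lc := Lc) c κ' t x z α' a) (fun κ u t => symVhS_translate hLc c κ u t)
    (fun κ t z w m b hz => symVhS_inr_fst_eq_zero (Lc := Lc) c κ t z w m b hz) hdiv h0

end Comb

end Summit.QuantumFields.BalabanUV.Beta.GAN24.CombEVHWordsZeroStep

end
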